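import Mathlib.Data.Fintype.Basic
import Mathlib.Data.Finset.Lattice.Fold
import HarnessLib

/-!
# N2 (the frames-only node, OPEN — scoping stage, no GO), a GO-INDEPENDENT combinatorial lemma: COFINAL COLOURS OF ADMISSIBLE SCALE PAIRS
# and the selectors that draw every pair through one colour (hp-8 g37, N2-SCOPE-F.md (V3)/(4.3))

builds on p205010 (kernel theorem, internal audit signed; external expert review pending) — nothing in this file uses p205010, no skeleton, no measure,
no node statement; NOTHING is claimed about the open nodes `SamePDropOfSkeletonFrm₁` / `SamePDropOfSkeletonNeg`.
Lane `prim-bschramm`, seat `prim-hp-8` (gen 37); helper file (`--supports stmt-CriticalPhenomena-4575 --as helper`).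

WHY.  Without a point symmetry, Martineau–Tassion's equilibrium lemma (their Lemma 3.5 read through the square-root trick in max-form) certifies, for
every seed zone size `M ≥ M₀` and every width `n ≥ n₁(M)`, exits through ONE vertical side and ONE slanted side only — a quadrant, i.e. a COLOUR of the
pair `(M, n)` in a finite palette (the two physical signs, possibly together with the orientation bit).  A Kozma–Nitzan re-run consumes several such
pairs (kit, short, long, bridge, face pairs) and needs them to share ONE colour.  Nothing at LEVEL 0 relates the colours of different pairs; but the
pigeonhole below shows that SOME colour is cofinal — beyond every `M₁` there is a zone size with arbitrarily large admissible widths of that colour —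
and then every pair can be drawn through the selectors `selM`/`selN`, which are nothing but (graph-dependent) values for the params ledger's residual
slots: each selected coordinate is `≥` the floor it is asked to clear, admissible, and of the common colour.
* `AdmCofinal adm M₀`, `admCofinal_of_threshold` (the `n ≥ n₁(M)` form);
* `ColourCofinal adm col c`, **`exists_colourCofinal`** (finite palette ⇒ a cofinal colour exists);
* `selM`, `selN`, `le_selM`, `le_selN`, `adm_selN`, `col_selN`.
[cite: MartineauTassion2017, §3.2 Lemma 3.2 (square-root trick without symmetry), Lemma 3.5] [folklore: pigeonhole]
-/

namespace Summit.CriticalPhenomena.PercolationContinuityZ3.Theorems.Transplant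

namespace Skelφ

namespace ScaleSel

variable {C : Type*}

/-- **Admissible widths are cofinal**: every zone size `M ≥ M₀` admits arbitrarily large admissible widths `n` (the shape of Martineau–Tassion's
`∃ n₁, ∀ n ≥ n₁` in Lemma 3.5). [cite: MartineauTassion2017, §3.2 Lemma 3.5] [this work] -/
def AdmCofinal (adm : ℕ → ℕ → Prop) (M₀ : ℕ) : Prop :=
  ∀ M, M₀ ≤ M → ∀ N, ∃ n, N ≤ n ∧ adm M n

/-- The threshold form `adm M n := n₁ M ≤ n` is cofinal (from any `M₀`). [folklore] -/
theorem admCofinal_of_threshold (n₁ : ℕ → ℕ) (M₀ : ℕ) : AdmCofinal (fun M n => n₁ M ≤ n) M₀ :=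
  fun M _ N => ⟨max N (n₁ M), le_max_left _ _, le_max_right _ _⟩

/-- A threshold form with an extra monotone-in-`n` requirement `P M n` that holds for all large `n` is cofinal. [folklore] -/
theorem admCofinal_of_eventually (adm : ℕ → ℕ → Prop) (M₀ : ℕ) (h : ∀ M, M₀ ≤ M → ∃ N₀, ∀ n, N₀ ≤ n → adm M n) :
    AdmCofinal adm M₀ := by
  intro M hM N
  obtain ⟨N₀, hN₀⟩ := h M hM
  exact ⟨max N N₀, le_max_left _ _, hN₀ _ (le_max_right _ _)⟩

/-- **A colour `c` is cofinal** for `(adm, col)`: beyond every `M₁` there is a zone size `M` with arbitrarily large admissible widths of colour `c`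
(the colour = the quadrant certified by the square-root trick in max-form). [cite: MartineauTassion2017, §3.2 Lemma 3.2] [this work] -/
def ColourCofinal (adm : ℕ → ℕ → Prop) (col : ℕ → ℕ → C) (c : C) : Prop :=
  ∀ M₁, ∃ M, M₁ ≤ M ∧ ∀ N, ∃ n, N ≤ n ∧ adm M n ∧ col M n = c

/-- **PIGEONHOLE: with a finite palette some colour is cofinal.**  If no colour were cofinal, each colour `c` would have a bound `M₁(c)` beyond which
every zone size has only boundedly many admissible widths of colour `c`; at a zone size above all `M₁(c)` (and `M₀`) take an admissible width above all
the resulting bounds — its own colour is contradicted. [folklore: pigeonhole] -/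
theorem exists_colourCofinal [Fintype C] {adm : ℕ → ℕ → Prop} {M₀ : ℕ} (h : AdmCofinal adm M₀) (col : ℕ → ℕ → C) :
    ∃ c, ColourCofinal adm col c := by
  classical
  by_contra hne
  -- no colour is cofinal: extract, per colour, a bound `M₁ c` and, per zone size above it, a width bound
  have hne' : ∀ c : C, ∃ M₁, ∀ M, M₁ ≤ M → ∃ N, ∀ n, N ≤ n → adm M n → col M n ≠ c := by
    intro c
    have hc : ¬ ColourCofinal adm col c := fun hc => hne ⟨c, hc⟩
    obtain ⟨M₁, hM₁⟩ := not_forall.1 hc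
    refine ⟨M₁, fun M hM => ?_⟩
    have hM' : ¬ ∀ N, ∃ n, N ≤ n ∧ adm M n ∧ col M n = c := fun hall => hM₁ ⟨M, hM, hall⟩
    obtain ⟨N, hN⟩ := not_forall.1 hM'
    refine ⟨N, fun n hn hadm hcol => hN ⟨n, hn, hadm, hcol⟩⟩
  choose M₁ hM₁ using hne'
  -- a zone size above every `M₁ c` and `M₀`
  have hM₀ : M₀ ≤ max M₀ (Finset.univ.sup M₁) := le_max_left _ _
  have hMc : ∀ c, M₁ c ≤ max M₀ (Finset.univ.sup M₁) := fun c =>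
    (Finset.le_sup (f := M₁) (Finset.mem_univ c)).trans (le_max_right _ _)
  choose N hN using fun c => hM₁ c (max M₀ (Finset.univ.sup M₁)) (hMc c)
  have hNc : ∀ c, N c ≤ Finset.univ.sup N := fun c => Finset.le_sup (f := N) (Finset.mem_univ c)
  obtain ⟨n, hn, hadm⟩ := h _ hM₀ (Finset.univ.sup N)
  exact hN (col _ n) n ((hNc _).trans hn) hadm rfl

variable {adm : ℕ → ℕ → Prop} {col : ℕ → ℕ → C} {c : C}

/-- **The zone-size selector**: a zone size `≥ M₁` in the cofinal colour's rows. [this work] -/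
noncomputable def selM (h : ColourCofinal adm col c) (M₁ : ℕ) : ℕ := Classical.choose (h M₁)

/-- The selected zone size clears its floor. [folklore] -/
theorem le_selM (h : ColourCofinal adm col c) (M₁ : ℕ) : M₁ ≤ selM h M₁ := (Classical.choose_spec (h M₁)).1

/-- At the selected zone size, admissible widths of colour `c` are cofinal. [folklore] -/
theorem selM_spec (h : ColourCofinal adm col c) (M₁ N : ℕ) : ∃ n, N ≤ n ∧ adm (selM h M₁) n ∧ col (selM h M₁) n = c :=
  (Classical.choose_spec (h M₁)).2 N

/-- **The width selector**: an admissible width `≥ N` of colour `c` at the selected zone size. [this work] -/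
noncomputable def selN (h : ColourCofinal adm col c) (M₁ N : ℕ) : ℕ := Classical.choose (selM_spec h M₁ N)

/-- The selected width clears its floor. [folklore] -/
theorem le_selN (h : ColourCofinal adm col c) (M₁ N : ℕ) : N ≤ selN h M₁ N := (Classical.choose_spec (selM_spec h M₁ N)).1

/-- The selected pair is admissible. [folklore] -/
theorem adm_selN (h : ColourCofinal adm col c) (M₁ N : ℕ) : adm (selM h M₁) (selN h M₁ N) := (Classical.choose_spec (selM_spec h M₁ N)).2.1

/-- The selected pair has the common colour. [folklore] -/
theorem col_selN (h : ColourCofinal adm col c) (M₁ N : ℕ) : col (selM h M₁) (selN h M₁ N) = c := (Classical.choose_spec (selM_spec h M₁ N)).2.2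

/-- **Drawing a finite list of pairs through one colour** (the form the params ledger uses: floors `M₁ i`, `N i` per pair, all selected pairs admissible,
of colour `c`, each clearing its floors). [this work] -/
theorem exists_pairs_of_colour (h : ColourCofinal adm col c) {ι : Type*} (M₁ N : ι → ℕ) :
    ∃ (M n : ι → ℕ), ∀ i, M₁ i ≤ M i ∧ N i ≤ n i ∧ adm (M i) (n i) ∧ col (M i) (n i) = c :=
  ⟨fun i => selM h (M₁ i), fun i => selN h (M₁ i) (N i), fun _ => ⟨le_selM h _, le_selN h _ _, adm_selN h _ _, col_selN h _ _⟩⟩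

end ScaleSel

end Skelφ

end Summit.CriticalPhenomena.PercolationContinuityZ3.Theorems.Transplant
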